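import Summits.CriticalPhenomena.PercolationContinuityZ3.Theorems.Transplant.SkelPhiFaceDataNbV
import Summits.CriticalPhenomena.PercolationContinuityZ3.Theorems.Transplant.SkelPhiFaceDataNb
import Summits.CriticalPhenomena.PercolationContinuityZ3.Theorems.Transplant.SkelPhiRootFootRun
import Summits.CriticalPhenomena.PercolationContinuityZ3.Theorems.Transplant.SkelPhiParaRunChain
import Summits.CriticalPhenomena.PercolationContinuityZ3.Theorems.Transplant.SkelPhiFaceRouteReadings
import Literature.Probability.Percolation.OrientedHistorySiteRenormalizationRun
import Summits.CriticalPhenomena.PercolationContinuityZ3.Theorems.Transplant.PlanarCells2VDefs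
import HarnessLib
import Summits.CriticalPhenomena.PercolationContinuityZ3.Theorems.Transplant.SkelPhiFaceNumsFoot
/-!
J23/(R-45) SUCCESSOR `…V` (hp-8 g42, 2026-08-23; ruling lead g12 11:31:15Z, design owner p3-g17 (R-44)/(R-45)): the twin of `SkelPhiFaceRouteReadingsT` over the cell structure with
per-axis ASYMMETRIC transverse rooms `PCells2V` (PlanarCells2VDefs: the slab family `Stub/Zone/Face/Hfull/faceLo/faceHi` has transverse interval `σ·[−hB∥, hF∥]`,
`hB, hF ≤ 2r⊥`, instead of `[−2r⊥, 2r⊥]`; every other box verbatim); statements and proofs VERBATIM with `PCells2T ↦ PCells2V` (+ the renames of record of the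
V layer below it); the only mathematical touch points are the places that read the symmetric transverse room (listed in the lane line of this file's landing).
NO landed file is edited; `SkelPhiFaceRouteReadingsT` stays valid (it is the instance `PCells2T.toV`, `hB = hF = 2r⊥`). NON-VACUITY: inherited verbatim from `SkelPhiFaceRouteReadingsT` (same witness line).

(R-40) SUCCESSOR `…T` (hp-8 g42, 2026-08-23; ruling p3-g16 06:23:56Z, J18): the twin of `SkelPhiFaceRouteReadingsS` over the PER-AXIS creep cap `PCells2V` (PlanarCells2TDefs:
`c i ≤ r (oth i)` instead of the uniform `c i ≤ cmax ≤ r j`); statements and proofs VERBATIM with `PCells2S ↦ PCells2V` (+ the renames of record of the T layer below it);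
the only mathematical touch points are the places that read the cap, which only ever need the cross form `c (oth j) ≤ r j` (listed in the lane line of this file's landing).
NO landed file is edited; `SkelPhiFaceRouteReadingsS` stays valid (and is an instance of this file through `PCells2S.toT`). NON-VACUITY: inherited verbatim from `SkelPhiFaceRouteReadingsS` (same witness line).

# N2 (frames-only node `SamePDropOfSkeletonFrm₁`, OPEN) — WAVE 1, (F) face-data column over STAGGERED cells ((R-22) `PCells2V`, (R-28)(β) one landing per file): the twin of N1's `SkelPhiFaceRouteReadings`

builds on p205010 (kernel theorem, internal audit signed; external expert review pending) — nothing in this file uses p205010; NOTHING is claimed about the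
open node `SamePDropOfSkeletonFrm₁` (`SamePDropOfSkeletonNeg₁` is CLOSED in the tree and untouched by this file).
Status sentence (coordinator 2026-08-20T04:30Z): "θ(p_c) = 0 on ℤ^d, all d ≥ 2 — kernel-verified (Lean 4/Mathlib, standard axioms); internal adversarial
audit SIGNED 2026-08-20 04:29Z; external expert review pending."
Lane `prim-bschramm`, seat `prim-hp-8` (gen 40); helper file (`--supports stmt-CriticalPhenomena-4575 --as helper`); design owner p3-g15 ((R-22) staggered
cells `PCells2V`, (R-27)/(R-29) far regions of record `FarNS/FarNS₂`, (R-28)(β), naming 2026-08-22T23:00:04Z: suffix `S`).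
PORT RULES (HOME/prim-hp-8/code/gen40/orient/bin/port_s.py = stmt-g19's port_orient.py + the G token table): the cells are `P : PCells2V`, every box is
read about the STAGGERED centre `cenS` (`PlanarCells2SDefs/SFar/ContainS/SArm/SepS/SepInfS/LevelsS/EfarN2S`), the scheme record is `cellGeomSG₂V`/`cellGeomSG₂bV`
(`SkelPhiCellsWeakGS/…SmallMS`: narrow arm `BtwNS`, two-block far region `FarNS₂`), the history-site API is the ORIENTED one at `qNE` where it occurs
(`ochoice qNE`, `onwardO`, `Valid₂O`, `IsRun₂O`, …, (R-18)); EVERY declaration is re-declared with the suffix `S` (same namespace). Docstrings/citations are N1's.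
N1 HEADER (kept for the reader):
* §1 `abs_ediv_add_sub_le_one`, **`abs_fineSkel_base_change`**; §2 `PCells2.farCore`, `mem_farCore_iff`, `farCore_spec`, **`mem_farCore_of_footBox`**;
* §3 **`mem_Mb_win_of_footBox`**; §4 **`runY_core_zero_of_runX_core`**, **`runX_core_zero_of_runY_core`**.
[cite: KozmaNitzan2024, §4 p. 26 (M_v, E_{v,x}), Lemma 11 (pp. 22–23), Lemma 12 (pp. 23–25)] [cite: MartineauTassion2017, §4.1, §4.3]
-/
noncomputable section

open scoped Classical

namespace Summit.CriticalPhenomena.PercolationContinuityZ3.Theorems.Transplant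

open Literature.Probability.Percolation Literature.Probability.LatticeModels SimpleGraph KNCells
open Literature.Probability.Percolation.KozmaNitzan
open Literature.Probability.Percolation.KozmaNitzan.Cells (oth oth_ne sgOf sgOf_sign stepVec_apply_fst stepVec_apply_oth eq_oth_of_ne oth_oth)
open Literature.Barriers.CriticalPhenomena (graphBall graphBall_finite mem_graphBall_self graphBall_mono)
open BoxProdZ2 (ConcRadiiG)
open TwoAxis.Para (coarse lam0 lam1 bp)

variable {V : Type} {G : SimpleGraph V} [G.LocallyFinite] {φ : V → Site 2}

/-! ## §1 The base change of the fine skeleton -/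

namespace Skelφ

end Skelφ

/-! ## §2 The habitat conversion -/

namespace PCells2V

variable (P : PCells2V)

/-- **The far core**: the cells of `farAS₂ x du j` whose transverse `k₀`-thickening at the same level stays in `farAS₂ x du j` (the planar set of the
face route's habitat: its frame window lies in the face-step region). [this work] -/
def farCore (x : Site 2) (du : MDir) (j : ℕ) (k₀ : ℤ) : Finset (Site 2) :=
  (P.farASS₂ x du j).filter fun z => ∀ z' : Site 2, z' du.1 = z du.1 → |z' (oth du.1) - z (oth du.1)| ≤ k₀ → z' ∈ P.farASS₂ x du j

/-- The defining property of the far core. [folklore] -/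
theorem farCore_spec {x : Site 2} {du : MDir} {j : ℕ} {k₀ : ℤ} :
    ∀ z ∈ (P : PCells2V).farCore x du j k₀, ∀ z' : Site 2, z' du.1 = z du.1 → |z' (oth du.1) - z (oth du.1)| ≤ k₀ → z' ∈ P.farASS₂ x du j :=
  fun _ hz => (Finset.mem_filter.1 hz).2

/-- **Membership in the far core from level/transverse bounds** (`0 ≤ k₀`). [folklore] -/
theorem mem_farCore_of_bounds {x : Site 2} {du : MDir} {j : ℕ} {k₀ : ℤ} (hk₀ : 0 ≤ k₀) {t : Site 2}
    (h1 : 5 * ((P : PCells2V).r du.1 : ℤ) + 10 * P.s du.1 * j + 2 ≤ P.lev du x t) (h2 : P.lev du x t ≤ 25 * P.r du.1 - 1)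
    (h3 : |t (oth du.1) - P.cenS x (oth du.1)| + k₀ + P.c du.1 ≤ 5 * P.r (oth du.1) - 3) : t ∈ P.farCore x du j k₀ := by
  have hc0 := P.c_nonneg du.1
  have habs := abs_nonneg (t (oth du.1) - P.cenS x (oth du.1))
  -- (R-30): every cell at the level of `t` within the transverse room lies in the block the level selects
  have key : ∀ z' : Site 2, P.lev du x z' = P.lev du x t → |z' (oth du.1) - P.cenS x (oth du.1)| + P.c du.1 ≤ 5 * P.r (oth du.1) - 3 →
      z' ∈ P.farASS₂ x du j := by
    intro z' hlev hz'
    by_cases hle : P.lev du x t ≤ 15 * P.r du.1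
    · exact P.mem_farASS₂_of_bounds_near (by rw [hlev]; exact h1) (by rw [hlev]; exact hle) (by linarith)
    · refine P.mem_farASS₂_of_bounds_far (by rw [hlev]; omega) (by rw [hlev]; exact h2) ?_
      rw [P.cenS_add_stepVec_oth]
      have hb := abs_le.1 (show |z' (oth du.1) - P.cenS x (oth du.1)| ≤ 5 * P.r (oth du.1) - 3 - P.c du.1 by linarith)
      rcases sgOf_sign du with hs | hs <;> rw [hs] <;> exact abs_le.2 ⟨by linarith, by linarith⟩
  refine Finset.mem_filter.2 ⟨key t rfl (by linarith), fun z' hz1 hz2 => ?_⟩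
  have hlev : P.lev du x z' = P.lev du x t := by unfold lev; rw [hz1]
  refine key z' hlev ?_
  calc |z' (oth du.1) - P.cenS x (oth du.1)| + P.c du.1
      = |(z' (oth du.1) - t (oth du.1)) + (t (oth du.1) - P.cenS x (oth du.1))| + P.c du.1 := by ring_nf
    _ ≤ |z' (oth du.1) - t (oth du.1)| + |t (oth du.1) - P.cenS x (oth du.1)| + P.c du.1 := by
        linarith [abs_add_le (z' (oth du.1) - t (oth du.1)) (t (oth du.1) - P.cenS x (oth du.1))]
    _ ≤ _ := by linarith

end PCells2V

namespace Skelφ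

/-- **HABITAT CONVERSION**: a vertex `w` whose base-`c` footprint lies in the box `FootBox flo fhi fw du`, with the contact's cell `z_c` (base `w₀`)
at level `lc := lev du x z_c` and transverse offset `|z_c ⊥ − cen x ⊥| ≤ wc`, has its base-`w₀` cell in `farCore x du j k₀` once
`5r∥ + 10s∥j + 3 ≤ flo + lc`, `fhi + lc ≤ 25r∥ − 2`, `fw + wc + k₀ + 1 ≤ 5r⊥ − 3`. [cite: KozmaNitzan2024, §4 p. 26, Lemma 12] -/
theorem mem_farCore_of_footBoxV (P : PCells2V) (t₀ c w : V) (A n h vα vβ c₀ c₁ : ℤ) {D : ℤ} (hD : 0 < D) {x : Site 2} {du : MDir} {j : ℕ}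
    {k₀ flo fhi fw wc : ℤ} (hk₀ : 0 ≤ k₀)
    (hfb : FootBox flo fhi fw du (fineSkel φ c A n h vα vβ c₀ c₁ (D / 2) (D / 2) D w))
    (hwc : |fineSkel φ t₀ A n h vα vβ c₀ c₁ (D / 2) (D / 2) D c (oth du.1) - P.cenS x (oth du.1)| ≤ wc)
    (hlo : 5 * (P.r du.1 : ℤ) + 10 * P.s du.1 * j + 3 ≤ flo + P.lev du x (fineSkel φ t₀ A n h vα vβ c₀ c₁ (D / 2) (D / 2) D c))
    (hhi : fhi + P.lev du x (fineSkel φ t₀ A n h vα vβ c₀ c₁ (D / 2) (D / 2) D c) ≤ 25 * P.r du.1 - 2)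
    (hw : fw + wc + k₀ + 1 + P.c du.1 ≤ 5 * (P.r (oth du.1) : ℤ) - 3) :
    fineSkel φ t₀ A n h vα vβ c₀ c₁ (D / 2) (D / 2) D w ∈ P.farCore x du j k₀ := by
  set zw := fineSkel φ t₀ A n h vα vβ c₀ c₁ (D / 2) (D / 2) D w with hzw
  set zc := fineSkel φ t₀ A n h vα vβ c₀ c₁ (D / 2) (D / 2) D c with hzc
  set zr := fineSkel φ c A n h vα vβ c₀ c₁ (D / 2) (D / 2) D w with hzr
  have hbc : ∀ i, |zw i - (zr i + zc i)| ≤ 1 := fun i => abs_fineSkel_base_change t₀ c w A n h vα vβ c₀ c₁ hD i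
  obtain ⟨hf1, hf2, hf3⟩ := hfb
  have hsg := sgOf_sign du
  have ha := abs_le.1 (hbc du.1)
  have hb := abs_le.1 (hbc (oth du.1))
  have hc' := abs_le.1 hwc
  have hf3' := abs_le.1 hf3
  refine P.mem_farCore_of_bounds hk₀ ?_ ?_ ?_
  · unfold PCells2V.lev at hlo ⊢
    rcases hsg with hs | hs <;> rw [hs] at hf1 hlo ⊢ <;> nlinarith
  · unfold PCells2V.lev at hhi ⊢
    rcases hsg with hs | hs <;> rw [hs] at hf2 hhi ⊢ <;> nlinarith
  · have : |zw (oth du.1) - P.cenS x (oth du.1)| ≤ fw + wc + 1 := by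
      rw [abs_le]; constructor <;> linarith
    linarith

/-! ## §3 The target conversion -/

/-- **TARGET CONVERSION**: a vertex `w ∈ B(w₀, R)` (`R + 1 ≤ rM`) whose base-`c` footprint lies in `FootBox glo ghi gw du` landing, after the shift by
the contact's cell `z_c`, inside `cen (x+du) ± (b₀ − 2)` lies in the small arrival box `VWin ψ w₀ (Mb b₀ (x + du)) rM` (a weak-step neighbour of
controlled footprint stays in `± b₀`). [cite: KozmaNitzan2024, §4 p. 26 (M_v), Lemma 11 (p. 22)] -/
theorem mem_Mb_win_of_footBoxV [DecidableEq V] (P : PCells2V) (t₀ c : V) (A n h vα vβ c₀ c₁ : ℤ) {D : ℤ} (hD : 0 < D)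
    (hlip : Lip G (fineSkel φ t₀ A n h vα vβ c₀ c₁ (D / 2) (D / 2) D)) (hws : WeakSteps G (fineSkel φ t₀ A n h vα vβ c₀ c₁ (D / 2) (D / 2) D))
    {x : Site 2} {du : MDir} {b₀ : Fin 2 → ℕ} {R rM : ℕ} (hR : R + 1 ≤ rM) {glo ghi gw : ℤ} {w : V} (hwB : w ∈ graphBall G t₀ R)
    (hfb : FootBox glo ghi gw du (fineSkel φ c A n h vα vβ c₀ c₁ (D / 2) (D / 2) D w))
    (hpar : ∀ s : ℤ, glo ≤ s → s ≤ ghi →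
      |sgOf du * s + fineSkel φ t₀ A n h vα vβ c₀ c₁ (D / 2) (D / 2) D c du.1 - P.cenS (x + stepVec du) du.1| + 2 ≤ b₀ du.1)
    (hperp : gw + |fineSkel φ t₀ A n h vα vβ c₀ c₁ (D / 2) (D / 2) D c (oth du.1) - P.cenS (x + stepVec du) (oth du.1)| + 2 ≤ b₀ (oth du.1)) :
    w ∈ VWin G (fineSkel φ t₀ A n h vα vβ c₀ c₁ (D / 2) (D / 2) D) t₀ (P.Mb b₀ (x + stepVec du)) rM := by
  set FS := fineSkel φ t₀ A n h vα vβ c₀ c₁ (D / 2) (D / 2) D with hFS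
  set zr := fineSkel φ c A n h vα vβ c₀ c₁ (D / 2) (D / 2) D w with hzr
  have hbc : ∀ i, |FS w i - (zr i + FS c i)| ≤ 1 := fun i => abs_fineSkel_base_change t₀ c w A n h vα vβ c₀ c₁ hD i
  obtain ⟨hf1, hf2, hf3⟩ := hfb
  have hsg := sgOf_sign du
  -- the cell of `w` is within `b₀ − 1` of `cen (x + du)`
  have hin : ∀ i, |FS w i - P.cenS (x + stepVec du) i| + 1 ≤ b₀ i := by
    intro i
    by_cases hi : i = du.1
    · subst hi
      have hp := hpar (sgOf du * zr du.1) hf1 hf2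
      have hs2 : sgOf du * (sgOf du * zr du.1) = zr du.1 := by
        rcases hsg with hs | hs <;> rw [hs] <;> ring
      rw [hs2] at hp
      have h1 := abs_le.1 (hbc du.1)
      have : |FS w du.1 - P.cenS (x + stepVec du) du.1| ≤ |zr du.1 + FS c du.1 - P.cenS (x + stepVec du) du.1| + 1 := by
        calc |FS w du.1 - P.cenS (x + stepVec du) du.1|
            = |(FS w du.1 - (zr du.1 + FS c du.1)) + (zr du.1 + FS c du.1 - P.cenS (x + stepVec du) du.1)| := by ring_nf
          _ ≤ |FS w du.1 - (zr du.1 + FS c du.1)| + |zr du.1 + FS c du.1 - P.cenS (x + stepVec du) du.1| := abs_add_le _ _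
          _ ≤ _ := by linarith [hbc du.1]
      linarith
    · rw [eq_oth_of_ne hi]
      have : |FS w (oth du.1) - P.cenS (x + stepVec du) (oth du.1)| ≤ gw + |FS c (oth du.1) - P.cenS (x + stepVec du) (oth du.1)| + 1 := by
        calc |FS w (oth du.1) - P.cenS (x + stepVec du) (oth du.1)|
            = |(FS w (oth du.1) - (zr (oth du.1) + FS c (oth du.1))) + zr (oth du.1) + (FS c (oth du.1) - P.cenS (x + stepVec du) (oth du.1))| := by
              ring_nf
          _ ≤ |(FS w (oth du.1) - (zr (oth du.1) + FS c (oth du.1))) + zr (oth du.1)| + |FS c (oth du.1) - P.cenS (x + stepVec du) (oth du.1)| :=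
              abs_add_le _ _
          _ ≤ |FS w (oth du.1) - (zr (oth du.1) + FS c (oth du.1))| + |zr (oth du.1)| + |FS c (oth du.1) - P.cenS (x + stepVec du) (oth du.1)| := by
              linarith [abs_add_le (FS w (oth du.1) - (zr (oth du.1) + FS c (oth du.1))) (zr (oth du.1))]
          _ ≤ _ := by linarith [hbc (oth du.1)]
      linarith
  -- a weak-step neighbour, both cells in `Mb`
  obtain ⟨m, hadj, -⟩ := hws w 0 1
  have hMv : ∀ s : Site 2, (∀ i, |s i - P.cenS (x + stepVec du) i| ≤ b₀ i) → s ∈ P.Mb b₀ (x + stepVec du) := fun s hs => by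
    rw [PCells2V.mem_Mb_iff]
    intro i
    have := abs_le.1 (hs i)
    constructor <;> linarith
  have hyM : FS w ∈ P.Mb b₀ (x + stepVec du) := hMv _ fun i => by have := hin i; linarith
  have hmM : FS m ∈ P.Mb b₀ (x + stepVec du) := hMv _ fun i => by
    have h1 := hlip hadj i
    have h2 := hin i
    calc |FS m i - P.cenS (x + stepVec du) i| = |(FS m i - FS w i) + (FS w i - P.cenS (x + stepVec du) i)| := by ring_nf
      _ ≤ |FS m i - FS w i| + |FS w i - P.cenS (x + stepVec du) i| := abs_add_le _ _
      _ ≤ _ := by rw [abs_sub_comm] at h1; linarith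
  exact mem_VWin_of_adj_footprints hwB hR hadj hyM hmM

/-! ## §4 The numeric cross links between an x-run and a y′-run -/

end Skelφ

end Summit.CriticalPhenomena.PercolationContinuityZ3.Theorems.Transplant

end

/-!
J23/(R-45) SUCCESSOR `…V` (hp-8 g42, 2026-08-23; ruling lead g12 11:31:15Z, design owner p3-g17 (R-44)/(R-45)): the twin of `SkelPhiFaceNumsFootT` over the cell structure with
per-axis ASYMMETRIC transverse rooms `PCells2V` (PlanarCells2VDefs: the slab family `Stub/Zone/Face/Hfull/faceLo/faceHi` has transverse interval `σ·[−hB∥, hF∥]`,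
`hB, hF ≤ 2r⊥`, instead of `[−2r⊥, 2r⊥]`; every other box verbatim); statements and proofs VERBATIM with `PCells2T ↦ PCells2V` (+ the renames of record of the
V layer below it); the only mathematical touch points are the places that read the symmetric transverse room (listed in the lane line of this file's landing).
NO landed file is edited; `SkelPhiFaceNumsFootT` stays valid (it is the instance `PCells2T.toV`, `hB = hF = 2r⊥`). NON-VACUITY: inherited verbatim from `SkelPhiFaceNumsFootT` (same witness line).

(R-40) SUCCESSOR `…T` (hp-8 g42, 2026-08-23; ruling p3-g16 06:23:56Z, J18): the twin of `SkelPhiFaceNumsFootS` over the PER-AXIS creep cap `PCells2V` (PlanarCells2TDefs: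
`c i ≤ r (oth i)` instead of the uniform `c i ≤ cmax ≤ r j`); statements and proofs VERBATIM with `PCells2S ↦ PCells2V` (+ the renames of record of the T layer below it);
the only mathematical touch points are the places that read the cap, which only ever need the cross form `c (oth j) ≤ r j` (listed in the lane line of this file's landing).
NO landed file is edited; `SkelPhiFaceNumsFootS` stays valid (and is an instance of this file through `PCells2S.toT`). NON-VACUITY: inherited verbatim from `SkelPhiFaceNumsFootS` (same witness line).

# N2 (frames-only node `SamePDropOfSkeletonFrm₁`, OPEN) — WAVE 1, (F) face-data column over STAGGERED cells ((R-22) `PCells2V`, (R-28)(β) one landing per file): the twin of N1's `SkelPhiFaceNumsFoot`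

builds on p205010 (kernel theorem, internal audit signed; external expert review pending) — nothing in this file uses p205010; NOTHING is claimed about the
open node `SamePDropOfSkeletonFrm₁` (`SamePDropOfSkeletonNeg₁` is CLOSED in the tree and untouched by this file).
Status sentence (coordinator 2026-08-20T04:30Z): "θ(p_c) = 0 on ℤ^d, all d ≥ 2 — kernel-verified (Lean 4/Mathlib, standard axioms); internal adversarial
audit SIGNED 2026-08-20 04:29Z; external expert review pending."
Lane `prim-bschramm`, seat `prim-hp-8` (gen 40); helper file (`--supports stmt-CriticalPhenomena-4575 --as helper`); design owner p3-g15 ((R-22) staggered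
cells `PCells2V`, (R-27)/(R-29) far regions of record `FarNS/FarNS₂`, (R-28)(β), naming 2026-08-22T23:00:04Z: suffix `S`).
PORT RULES (HOME/prim-hp-8/code/gen40/orient/bin/port_s.py = stmt-g19's port_orient.py + the G token table): the cells are `P : PCells2V`, every box is
read about the STAGGERED centre `cenS` (`PlanarCells2SDefs/SFar/ContainS/SArm/SepS/SepInfS/LevelsS/EfarN2S`), the scheme record is `cellGeomSG₂V`/`cellGeomSG₂bV`
(`SkelPhiCellsWeakGS/…SmallMS`: narrow arm `BtwNS`, two-block far region `FarNS₂`), the history-site API is the ORIENTED one at `qNE` where it occurs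
(`ochoice qNE`, `onwardO`, `Valid₂O`, `IsRun₂O`, …, (R-18)); EVERY declaration is re-declared with the suffix `S` (same namespace). Docstrings/citations are N1's.
N1 HEADER (kept for the reader):
* `PCells2.lev_cen_add_stepVec`, **`Skelφ.not_mem_MbWin_of_near`**, `Skelφ.disjoint_MbWin_of_near`.
[cite: KozmaNitzan2024, §4 p. 26 (M_v), Lemma 11 (p. 22)]
-/
noncomputable section

open scoped Classical

namespace Summit.CriticalPhenomena.PercolationContinuityZ3.Theorems.Transplant

open Literature.Probability.Percolation Literature.Probability.LatticeModels KNCells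
open Literature.Probability.Percolation.KozmaNitzan
open Literature.Probability.Percolation.KozmaNitzan.Cells (oth oth_ne sgOf sgOf_sign stepVec_apply_fst stepVec_apply_oth eq_oth_of_ne oth_oth)
open Literature.Barriers.CriticalPhenomena (graphBall)

/-- The next cube's centre sits at planar level `20·r∥`. [folklore] -/
theorem PCells2V.lev_cen_add_stepVec (P : PCells2V) (x : Site 2) (du : MDir) : P.lev du x (P.cenS (x + stepVec du)) = 20 * (P.r du.1 : ℤ) := by
  unfold PCells2V.lev
  rw [P.cenS_add_stepVec_fst]
  have hsq : sgOf du * sgOf du = 1 := by rcases sgOf_sign du with h | h <;> rw [h] <;> norm_num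
  linear_combination (20 * (P.r du.1 : ℤ)) * hsq

namespace Skelφ

variable {V : Type} [DecidableEq V] {G : SimpleGraph V} [G.LocallyFinite] {φ : V → Site 2}

/-- **THE ARRIVAL BOX IS OFF THE NEAR ZONE**: a vertex whose base-`c` cell coordinate on the face's axis is at most `k` lies outside
`VWin ψ w₀ (Mb b₀ (x + du)) R` once `lev(z_c) + k + 1 < 20·r∥ − b₀∥`. [cite: KozmaNitzan2024, §4 p. 26, Lemma 11 (p. 22)] -/
theorem not_mem_MbWin_of_nearV (P : PCells2V) (w₀ c : V) (A n h vα vβ c₀ c₁ : ℤ) {D : ℤ} (hD : 0 < D) {x : Site 2} {du : MDir} {b₀ : Fin 2 → ℕ}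
    {R : ℕ} {k Lc : ℤ} {v : V} (hk : |fineSkel φ c A n h vα vβ c₀ c₁ (D / 2) (D / 2) D v du.1| ≤ k)
    (hLc : P.lev du x (fineSkel φ w₀ A n h vα vβ c₀ c₁ (D / 2) (D / 2) D c) ≤ Lc) (hfar : Lc + k + 1 < 20 * (P.r du.1 : ℤ) - b₀ du.1) :
    v ∉ VWin G (fineSkel φ w₀ A n h vα vβ c₀ c₁ (D / 2) (D / 2) D) w₀ (P.Mb b₀ (x + stepVec du)) R := by
  intro hv
  have hW := (mem_Win G _).1 (VWin_subset_Win w₀ _ _ hv)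
  have hM := (PCells2V.mem_Mb_iff (P := P)).1 hW.2 du.1
  have hbc := abs_le.1 (abs_fineSkel_base_change (φ := φ) w₀ c v A n h vα vβ c₀ c₁ hD du.1)
  have hk' := abs_le.1 hk
  have hcen := P.lev_cen_add_stepVec x du
  unfold PCells2V.lev at hLc hcen
  have hσ := sgOf_sign du
  rcases hσ with hs | hs <;> rw [hs] at hLc hcen <;> nlinarith [hM.1, hM.2, hbc.1, hbc.2, hk'.1, hk'.2]

/-- **`hMZ`**: a finite set of near vertices (each within `k` on the face's axis) is disjoint from the arrival box. [folklore] -/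
theorem disjoint_MbWin_of_nearV (P : PCells2V) (w₀ c : V) (A n h vα vβ c₀ c₁ : ℤ) {D : ℤ} (hD : 0 < D) {x : Site 2} {du : MDir}
    {b₀ : Fin 2 → ℕ} {R : ℕ} {k Lc : ℤ} {Z : Finset V} (hk : ∀ v ∈ Z, |fineSkel φ c A n h vα vβ c₀ c₁ (D / 2) (D / 2) D v du.1| ≤ k)
    (hLc : P.lev du x (fineSkel φ w₀ A n h vα vβ c₀ c₁ (D / 2) (D / 2) D c) ≤ Lc) (hfar : Lc + k + 1 < 20 * (P.r du.1 : ℤ) - b₀ du.1) :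
    Disjoint (VWin G (fineSkel φ w₀ A n h vα vβ c₀ c₁ (D / 2) (D / 2) D) w₀ (P.Mb b₀ (x + stepVec du)) R) Z :=
  Finset.disjoint_right.2 fun v hv => not_mem_MbWin_of_nearV P w₀ c A n h vα vβ c₀ c₁ hD (hk v hv) hLc hfar

end Skelφ

end Summit.CriticalPhenomena.PercolationContinuityZ3.Theorems.Transplant

end
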